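import Summits.SmoothPoincare4.SmoothPoincare4.Theorems.SoloInformedEmbeddingRoute
import Summits.SmoothPoincare4.SmoothPoincare4.Theorems.SoloInformedPuncturedEmbedding
import Literature.Geometry.Manifold.SmoothEmbeddingCodRestrict
import HarnessLib
import HarnessLib.Audit.Tags

/-!
# SPC4 from the PUNCTURED embedding property and the Schoenflies conjecture: the path's first
# conjunct in the form SPC4 gives back

Solo informed SmoothPoincare4, session 21.  The landed path theorem
`smoothPoincare4_of_poincareBallEmbedding_of_schoenfliesBallConjecture`
(`SoloInformedEmbeddingRoute.lean`) reads `EMB → SS4 → (Γ₄ = 0) → SPC4` with EMB the Poincaré-ball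
embedding conjecture `PoincareBallEmbeddingConjecture` (Hass–Kirby 2025, Question 4.2: every
compact contractible smooth 4-manifold with boundary `S³` embeds in `S⁴`).  Session 19 typed the
boundary-free form EMB° = `PuncturedPoincareSphereEmbedding` (`SoloInformedPuncturedEmbedding.lean`:
every punctured homotopy 4-sphere `Σ ∖ {p}` is diffeomorphic to an open subset of the round `S⁴`)
and proved `SPC4 → EMB°` (`puncturedPoincareSphereEmbedding_of_smoothPoincare4`) and
`EMB° → (homotopy-ball-slice ⇒ slice)`; the equivalence EMB ⟺ EMB° (a collar argument) was left
unformalised.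

This file proves that EMB° ALREADY suffices in the path:

  `smoothPoincare4_of_puncturedEmbedding_of_schoenfliesBallConjecture :`
  `PuncturedPoincareSphereEmbedding → SchoenfliesBallConjectureFour → cerf_twistedSphere_four →`
  `SmoothPoincare4`,

so that, GIVEN the Schoenflies conjecture (ball form) and `Γ₄ = 0`, SPC4 is EQUIVALENT to EMB°
with both directions kernel-checked (`smoothPoincare4_iff_puncturedEmbedding`).  Consequently the
first conjunct of the path may be taken to be exactly the statement that the
homotopy-ball-slice / `s`-invariant programme refutes at kernel level
(`not_puncturedPoincareSphereEmbedding_of_isHomotopyBallSlice_not_isSmoothlySlice`,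
`not_puncturedPoincareSphereEmbedding_of_fgmwRasmussenStrategy`), with no unformalised collar
argument in between; and the ball form EMB implies EMB° modulo the same two hypotheses
(`puncturedEmbedding_of_poincareBallEmbedding_of_schoenfliesBallConjecture`).

Proof of the main theorem (all steps proved; the only inputs carried as hypotheses are the two
conjectures and Cerf's theorem): for a homotopy 4-sphere `M` (compact), puncture
`M = W ∪_ψ 𝔻⁴` with `W = {a ≤ f}` the regular superlevel set of a Morse function and
`{f ≤ a} ≅ 𝔻⁴` (`exists_isBoundaryGluing_superlevel_closedBall`); `W` is contractible
(`RegularSublevel.contractibleSpace_superlevel_of_homotopyEquiv_sphere`).  NEW STEP: the level `a`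
is not the minimum of `f` — a minimum on a boundaryless compact manifold is a critical point
(Fermat, `IsLocalMin.isMCriticalPt`) and `a` is a regular level with `{f ≤ a} ≠ ∅` — so there is a
point `p₀` with `f p₀ < a`, i.e. `p₀ ∉ W` (`exists_apply_lt_of_isRegularLevel`); by EMB° at `p₀`,
`M ∖ {p₀} ≅ U ⊆ S⁴`, and the inclusion `W ↪ M ∖ {p₀}` (a smooth embedding of a manifold with
boundary into an open submanifold, `RegularSublevel.isSmoothEmbedding_incl` +
`Manifold.IsSmoothEmbedding.opensCodRestrict`) followed by that diffeomorphism and `U ↪ S⁴`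
(`Manifold.IsSmoothEmbedding.diffeomorph_comp`, `Manifold.IsSmoothEmbedding.subtypeVal_comp`) is
a smooth embedding `W ↪ S⁴`.  Then, as in the landed file: Schoenflies gives `W ≅ 𝔻⁴`,
transporting the gluing makes `M` a twisted sphere, and `Γ₄ = 0` gives `M ≅ S⁴`.

Sources: J. Hass, R. Kirby, *Characterizing the 4-sphere, `S⁴`*, J. Open Math. Problems 1 (2025),
§4 p. 62, Lemma 4.1 and Question 4.2 [HassKirby2025]; D. Gabai, *3-Spheres in the 4-sphere and
pseudo-isotopies of `S¹ × S³`*, arXiv:2212.02004, §13 p. 62 [Gabai2022]; M. Freedman, R. Gompf,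
S. Morrison, K. Walker, Quantum Topol. 1 (2010), §1–2 [FreedmanGompfMorrisonWalker2010] (the
punctured form is the one their `s`-invariant strategy negates).  No new axioms, no `sorry`, no
new definitions; nothing here decides any of the three hypotheses.
-/

noncomputable section

open scoped Manifold ContDiff Topology
open Set Function ContinuousMap

namespace Summit.SmoothPoincare4.SmoothPoincare4.Theorems

open Literature.Topology.FourManifolds Literature.Geometry.Manifold

/-! ### A regular level with nonempty sublevel set is not the minimum -/

/-- **Below a regular level there is a point.**  If `a` is a regular level of the smooth function
`f` on a compact boundaryless manifold `M` and the sublevel set `{f ≤ a}` is nonempty, then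
`f p < a` for some `p`: otherwise a point of `{f ≤ a}` is a global minimum of `f` with value `a`,
hence a critical point on the level `a` (Fermat's theorem on a boundaryless manifold,
`IsLocalMin.isMCriticalPt`), contradicting regularity. [folklore] -/
theorem exists_apply_lt_of_isRegularLevel {k : ℕ} {M : Type} [TopologicalSpace M]
    [CompactSpace M] [ChartedSpace (EuclideanSpace ℝ (Fin (k + 1))) M]
    [IsManifold (𝓡 (k + 1)) ∞ M] {f : M → ℝ} {a : ℝ} (h : IsRegularLevel (𝓡 (k + 1)) f a)
    (q : RegularSublevel h) : ∃ p : M, f p < a := by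
  haveI : Nonempty M := ⟨RegularSublevel.incl h q⟩
  obtain ⟨p, -, hpmin⟩ :=
    isCompact_univ.exists_isMinOn univ_nonempty h.contMDiff.continuous.continuousOn
  refine ⟨p, lt_of_not_ge fun hap => ?_⟩
  have hpa : f p = a :=
    le_antisymm ((hpmin (mem_univ (RegularSublevel.incl h q))).trans
      (RegularSublevel.apply_incl_le h q)) hap
  have hploc : IsLocalMin f p := hpmin.isLocalMin Filter.univ_mem
  have hpc : IsMCriticalPt (𝓡 (k + 1)) f p := hploc.isMCriticalPt
  exact h.not_isMCriticalPt hpa hpc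

/-! ### The main theorem -/

/-- **SPC4 from the punctured embedding property and the Schoenflies conjecture (ball form),
given `Γ₄ = 0`.**  If every punctured homotopy 4-sphere is diffeomorphic to an open subset of
`S⁴` (`PuncturedPoincareSphereEmbedding`), every compact smooth 4-manifold with boundary `≅ S³`
that smoothly embeds in `S⁴` is a disc (`hS`, the Schoenflies conjecture in Gabai's ball form),
and twisted 4-spheres are standard (`cerf_twistedSphere_four`), then every smooth homotopy
4-sphere is diffeomorphic to `S⁴`.  Proof: puncture `M = W ∪_ψ 𝔻⁴`, `W = {a ≤ f}` contractible;
pick `p₀` with `f p₀ < a` (`exists_apply_lt_of_isRegularLevel`); `W ↪ M ∖ {p₀} ≅ U ↪ S⁴` is a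
smooth embedding; Schoenflies makes `W` a disc; transport the gluing; Cerf.  Hass–Kirby 2025 §4
(Lemma 4.1, Question 4.2) with Question 4.2 in its punctured form.
[cite: HassKirby2025, §4 Lemma 4.1 and Question 4.2] -/
theorem smoothPoincare4_of_puncturedEmbedding_of_schoenfliesBall
    (hE : PuncturedPoincareSphereEmbedding)
    (hS : ∀ (W : Type) [TopologicalSpace W] [T2Space W] [SecondCountableTopology W]
      [ChartedSpace (EuclideanHalfSpace (3 + 1)) W] [IsManifold (𝓡∂ (3 + 1)) ∞ W] [CompactSpace W]
      (b : BoundaryData (𝓡∂ (3 + 1)) W (𝓡 3)),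
      Nonempty (b.carrier ≃ₘ⟮𝓡 3, 𝓡 3⟯ (Metric.sphere (0 : EuclideanSpace ℝ (Fin (3 + 1))) 1)) →
      (∃ φ : W → (Metric.sphere (0 : EuclideanSpace ℝ (Fin (3 + 1 + 1))) 1),
        Manifold.IsSmoothEmbedding (𝓡∂ (3 + 1)) (𝓡 (3 + 1)) ∞ φ) →
      Nonempty (W ≃ₘ⟮𝓡∂ (3 + 1), 𝓡∂ (3 + 1)⟯
        (Metric.closedBall (0 : EuclideanSpace ℝ (Fin (3 + 1))) 1)))
    (hC : cerf_twistedSphere_four) : SmoothPoincare4 := by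
  intro M _ _ _ _ _ e
  haveI : CompactSpace M := compactSpace_of_homotopyEquiv_sphere (n := 4) (by norm_num) M e
  obtain ⟨y, hy⟩ := (NormedSpace.sphere_nonempty (E := EuclideanSpace ℝ (Fin (4 + 1)))
    (x := (0 : EuclideanSpace ℝ (Fin (4 + 1)))) (r := (1 : ℝ))).2 zero_le_one
  haveI : Nonempty M := ⟨e.symm.toFun ⟨y, hy⟩⟩
  -- puncture: `M = W ∪_ψ 𝔻⁴`, `W = {a ≤ f}`, `{f ≤ a} ≅ 𝔻⁴`
  obtain ⟨f, a, h, ψ, G, ⟨Ψ⟩⟩ :=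
    exists_isBoundaryGluing_superlevel_closedBall M (k := 3) (by norm_num)
  -- `W` is a Poincaré ball
  haveI : ContractibleSpace (RegularSuperlevel h) :=
    RegularSublevel.contractibleSpace_superlevel_of_homotopyEquiv_sphere (by norm_num) h Ψ e
  -- a point strictly below the level, i.e. outside `W`
  obtain ⟨p₀, hp₀⟩ := exists_apply_lt_of_isRegularLevel h
    (Ψ.symm ⟨0, Metric.mem_closedBall_self zero_le_one⟩)
  -- the inclusion `W ↪ M ∖ {p₀}` is a smooth embedding into the open submanifold
  set V : TopologicalSpace.Opens M := ⟨({p₀}ᶜ : Set M), isOpen_compl_singleton⟩ with hV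
  have hWV : ∀ w : RegularSuperlevel h, RegularSublevel.incl h.const_sub w ∈ V := by
    intro w hw
    have hle : a ≤ f (RegularSublevel.incl h.const_sub w) :=
      (level_le_iff_const_sub_nonpos _).2 (RegularSublevel.apply_incl_le h.const_sub w)
    rw [mem_singleton_iff.mp hw] at hle
    exact absurd hp₀ (not_lt.2 hle)
  have h₁ : Manifold.IsSmoothEmbedding (𝓡∂ (3 + 1)) (𝓡 (3 + 1)) ∞
      (fun w ↦ (⟨RegularSublevel.incl h.const_sub w, hWV w⟩ : V)) :=
    (RegularSublevel.isSmoothEmbedding_incl h.const_sub).opensCodRestrict V hWV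
  -- by the punctured embedding property, `M ∖ {p₀} ≅ U ⊆ S⁴`; compose
  obtain ⟨U, ⟨χ⟩⟩ := hE M ⟨e⟩ p₀
  have h₂ : Manifold.IsSmoothEmbedding (𝓡∂ (3 + 1)) (𝓡 (3 + 1)) ∞
      (Subtype.val ∘ ((χ : V → U) ∘ fun w ↦ (⟨RegularSublevel.incl h.const_sub w, hWV w⟩ : V))) :=
    Manifold.IsSmoothEmbedding.subtypeVal_comp U (h₁.diffeomorph_comp χ)
  -- so `W` is a Schoenflies ball, hence a disc
  obtain ⟨g⟩ := hS (RegularSuperlevel h) (RegularSublevel.boundaryData h.const_sub) ⟨ψ⟩ ⟨_, h₂⟩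
  -- `M = 𝔻⁴ ∪_χ 𝔻⁴` is a twisted sphere, diffeomorphic to `S⁴` by Cerf
  have G₃ := IsBoundaryGluing.transfer (b₁ := closedBallBoundaryData 3) g.symm G
  exact hC (((closedBallBoundaryData 3).restrictDiffeomorph
      (RegularSublevel.boundaryData h.const_sub) g.symm).trans ψ)
    { carrier := M, isTwistedSphere := G₃ }

/-- Named-hypothesis form: **(punctured embedding property) → (Schoenflies conjecture, ball form)
→ (`Γ₄ = 0`) → SPC4**. [cite: HassKirby2025, §4 Lemma 4.1 and Question 4.2] -/
theorem smoothPoincare4_of_puncturedEmbedding_of_schoenfliesBallConjecture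
    (hE : PuncturedPoincareSphereEmbedding) (hS : SchoenfliesBallConjectureFour)
    (hC : cerf_twistedSphere_four) : SmoothPoincare4 :=
  smoothPoincare4_of_puncturedEmbedding_of_schoenfliesBall hE hS hC

/-- **Modulo the Schoenflies conjecture (ball form) and `Γ₄ = 0`, SPC4 is equivalent to the
punctured embedding property**, both directions kernel-checked: `→` restricts a diffeomorphism
`M ≅ S⁴` (`puncturedPoincareSphereEmbedding_of_smoothPoincare4`), `←` is the main theorem of this
file.  Hass–Kirby 2025, §4 (Lemma 4.1 and the sentence after Question 4.2).
[cite: HassKirby2025, §4 Lemma 4.1 and Question 4.2] -/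
theorem smoothPoincare4_iff_puncturedEmbedding (hS : SchoenfliesBallConjectureFour)
    (hC : cerf_twistedSphere_four) : SmoothPoincare4 ↔ PuncturedPoincareSphereEmbedding :=
  ⟨puncturedPoincareSphereEmbedding_of_smoothPoincare4,
    fun hE ↦ smoothPoincare4_of_puncturedEmbedding_of_schoenfliesBallConjecture hE hS hC⟩

/-- **The ball form of the embedding conjecture implies the punctured form, modulo the
Schoenflies conjecture (ball form) and `Γ₄ = 0`** (through SPC4: the landed
`smoothPoincare4_of_poincareBallEmbedding_of_schoenfliesBallConjecture` followed by
`puncturedPoincareSphereEmbedding_of_smoothPoincare4`).  The unconditional implication (a collar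
argument) is not formalised. [cite: HassKirby2025, §4 Question 4.2] -/
theorem puncturedEmbedding_of_poincareBallEmbedding_of_schoenfliesBallConjecture
    (hE : PoincareBallEmbeddingConjecture) (hS : SchoenfliesBallConjectureFour)
    (hC : cerf_twistedSphere_four) : PuncturedPoincareSphereEmbedding :=
  puncturedPoincareSphereEmbedding_of_smoothPoincare4
    (smoothPoincare4_of_poincareBallEmbedding_of_schoenfliesBallConjecture hE hS hC)

/-- **A knot slice in a homotopy 4-ball but not slice refutes SPC4 already through the first
conjunct of the path, and conversely the path needs nothing more on that side**: modulo
Schoenflies (ball form) and `Γ₄ = 0`, such a knot is exactly an obstruction to SPC4's first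
conjunct EMB° (`not_puncturedPoincareSphereEmbedding_of_isHomotopyBallSlice_not_isSmoothlySlice`).
Stated as: under the two hypotheses, SPC4 implies that homotopy-ball-slice knots are slice, via
EMB°.  Freedman–Gompf–Morrison–Walker 2010, §2 Fact 2.1.
[cite: FreedmanGompfMorrisonWalker2010, §2 Fact 2.1] -/
theorem isSmoothlySlice_of_isHomotopyBallSlice_of_smoothPoincare4 (h : SmoothPoincare4)
    (K : Knot) (hK : K.IsHomotopyBallSlice) : K.IsSmoothlySlice :=
  isSmoothlySlice_of_isHomotopyBallSlice_of_puncturedEmbedding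
    (puncturedPoincareSphereEmbedding_of_smoothPoincare4 h) K hK

end Summit.SmoothPoincare4.SmoothPoincare4.Theorems

end
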